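import Summits.QuantumFields.BalabanUV.Beta.FP.TowerQN2HN2ReadersChartGeneric
import Summits.QuantumFields.BalabanUV.Beta.CompositeOneShotJetsGraded

/-!
# `BalabanUV.Beta.FP.TowerHN2ReadersChartGenericG` — road «FP», THE GRADED TWIN (σ_T) OF R-C15 `FP.TowerHN2ReadersChartGeneric` ((c)∕(L-v10) wave R-2, readers part 1c), FILED UNDER director-ym g23 [DIRYM-G23-INBOX-9]
# ruling (1) «located repair σ_T `tabsComp ↦ tabsCompG`» + «`a2` = S-END-G (road, #169 key)»: R-C15 with the ONE token `tabsComp ↦ tabsCompG` — the DOOR ∕ `hHN₂` cluster's two table-displaying chart-generic readers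
# `hHN2_of_locks_of_junctions_of_readingAG` (`.HN2Row`), `hJΛ2_of_mixedLock_of_mixedGauge_doorAG` (`.MixedDoor`; R-C15's table-free `hJΛ2'_of_wardRow_doorA` is not twinned) with their displayed MIXED-table words `(M2Of 3 (Lc^(n+2)) (tabsCompG (n+2) …)).mixFF …`
# (= `compMixG`, the LOCATED word of A2-LOCATE 547291ba ∕ j333652; `tabsCompG_mixFF`, `rfl`) and Λ-words `(tabsCompG …).H` (= the ungraded `.H`, `tabsCompG_H_eq_tabsComp_H`).  WHY (E-FP-73-3 = E-AN2-94-3, CONFIRMED;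
# director rider #2): S-END's located rows `a2` ∧ `hM₂` display the UNGRADED `(tabsComp …).mixFF = compMix`, located-false at (4,3) (A2.md f2ed6054); the by-value-certified tower is the GRADED one
# (`prestab/sym2/STARTED-SYM2` 3b67f41a §Q6); S-END-G re-displays those rows at `tabsCompG` and consumes THIS file's readers by name.  Nodes table-OPAQUE (tables enter only through the displayed words):
# statements = R-C15's under the token, proofs VERBATIM (R-C15 uses no `tabsComp`-specific lemma).  NOT S-END-G; not R-C16-G…R-C19-G (those wait on the row's graded carrier `WNAG`); 0 defs; [folklore]
# lemmas over OUR objects; nothing cited; no `def … : Prop`; 0 sorry; nothing of Bałaban's asserted (ABSOLUTE RULE); 0 estimates; 0∕4 row-D1 binders; `hlawLG`, (J-m2)″ OPEN by name; NOT (C1), NOT (T-ID),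
# NOT SDF, NOT D1, NEVER «G-an2-4 closed», NOT BetaPertH, NOT continuum, NOT Clay.  COUNT SENTENCE (c3): «0∕4; `D1Tel` at `JcSymLG` MODULO `hlawLG` MODULO v10's sym rows (graded)».

HONEST DEPENDENCY (page 1, mandatory): continuum YM on T⁴ ⇐ BetaPertH ∧ nine spine estimates (0/9 proved); BetaPertH ⇐ (D1) ∧ (D4) ∧ CAP+tail;
G-an2-4 gates asym, D1 and NE2/3/4.  HONEST FRAMING (cell contract, verbatim): «discharging `BetaPertH` makes Bałaban's UV stability UNCONDITIONAL —
a real constructive-QFT result; it is NOT the continuum limit and NOT the Clay problem.»  ABSOLUTE RULE (cell charter, verbatim): «No internally-minted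
statement may enter as a cited fact. Every hypothesis is either kernel-proved in this package or a verbatim quotation of a PUBLISHED theorem with page
reference. The manuscript(s) under audit are NOT citable for their own disputed steps — they are the thing under adjudication; programme-internal
(2001/route/tribunal) claims are never citable.»  Road «FP» OWNER, b2b-balaban-beta-d1-p3 gen 73, 2026-08-31.  No existing file touched.
-/

noncomputable section

open scoped BigOperators Matrix

namespace Summit.QuantumFields.BalabanUV.Beta.FP.TowerHN2ReadersChartGenericG.HN2Row


open Finset Matrix
open Literature.MathematicalPhysics.QuantumFieldTheory
open Literature.MathematicalPhysics.QuantumFieldTheory.Balaban1983to89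
open Literature.MathematicalPhysics.QuantumFieldTheory.Balaban1983to89.Beta
open B4TorusKernel.MultiPeriod (translate)
open B5Prop11Plancherel (fine)
open B6Lemma24Torus (pbox)
open AffineAveraging (Site box toSite)
open AveragingContoursRooted (ctr ctrOff)
open OneStepResolventKernel (Fib)
open StepJetData (wilsonA)
open WilsonBiStencil (wilsonW₂)
open BalabanStepW2 (M2Of)
open Summit.QuantumFields.BalabanUV.Beta.TameKernelCalculus (trK)
open Summit.QuantumFields.BalabanUV.Beta.BorderedHessian (sgnK)
open Summit.QuantumFields.BalabanUV.Beta.SymShiftedSpread (bhKStepSh)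
open Summit.QuantumFields.BalabanUV.Beta.DshAn1 (Dsh)
open Summit.QuantumFields.BalabanUV.Beta.AxialDressingRooted (one_le_of_neZero)
open Summit.QuantumFields.BalabanUV.Beta.CompositeOneShotJetsGraded (tabsCompG)
open Summit.QuantumFields.BalabanUV.Beta.CompositeOneShotJetData (Roots Pins AN WN)
open Summit.QuantumFields.BalabanUV.Beta.FP.KernelPeriodisationFib (Idx perF)
open Summit.QuantumFields.BalabanUV.Beta.FP.KernelPeriodisationFibLoc (dper)
open Summit.QuantumFields.BalabanUV.Beta.FP.TorusGaugeCovariance (tgrad)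
open Summit.QuantumFields.BalabanUV.Beta.FP.TorusGaugeCovariancePairing (wrapPt)
open Summit.QuantumFields.BalabanUV.Beta.FP.TorusCompositeObjects (towerTorus)
open Summit.QuantumFields.BalabanUV.Beta.FP.TowerQN2RowCopies (towerTorus_fine_apply)


open Summit.QuantumFields.BalabanUV.Beta.FP.TorusGaugeCovariancePairing (wrapPt_coe)
open Summit.QuantumFields.BalabanUV.Beta.FP.TowerQN2RowFamily (perF_dper_woundEven_wrap)

open Summit.QuantumFields.BalabanUV.Beta.FP.TowerHN2Row (sum_sum_mul_half_symm)
open Summit.QuantumFields.BalabanUV.Beta.FP.TowerQN2HN2ReadersChartGeneric.HN2Jet (Hprime2_symm_eq_sq_smul_bivertex_cols_add_remA)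
open ExpKernelCalculus (MKer)



section RowHR

variable {Lc : ℕ} [NeZero Lc] (M : Fin (3 + 1) → ℕ) [∀ μ, NeZero (M μ)] (n : ℕ) (c : ℝ) (Pn : Pins) (A : MKer (3 + 1) (Fib 3))
  {κ : Type*} [DecidableEq κ] (yN : κ → Site (3 + 1)) (μN : κ → Fin (3 + 1))
  -- #7 `TowerHN2RowJet` §3's letters VERBATIM
  (hv : (κ → ℝ) → (↥(pbox (towerTorus Lc (fine Lc M) (n + 1))) × Fin (3 + 1) → ℝ))
  (hhvl : ∀ (r : ℝ) (x y : κ → ℝ), hv (r • x + y) = r • hv x + hv y)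
  (lv : (κ → ℝ) → (↥(pbox (towerTorus Lc (fine Lc M) (n + 1))) → ℝ))
  (hlv : ∀ (r : ℝ) (x y : κ → ℝ), lv (r • x + y) = r • lv x + lv y)
  (hJW : ∀ (a : κ) (b : ↥(pbox (towerTorus Lc (fine Lc M) (n + 1))) × Fin (3 + 1)), hv (Pi.single a 1) b
      = perF (towerTorus Lc (fine Lc M) (n + 1)) A (b.1, Sum.inl b.2)
          (wrapPt (towerTorus Lc (fine Lc M) (n + 1)) (((Lc ^ (n + 1 + 1) : ℕ) : ℤ) • yN a), Sum.inr (μN a))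
        - ∑ s : ↥(pbox (towerTorus Lc (fine Lc M) (n + 1))), tgrad (towerTorus Lc (fine Lc M) (n + 1)) (b.1, Sum.inl b.2) s * lv (Pi.single a 1) s)
  {H₀ : Matrix (↥(pbox (towerTorus Lc (fine Lc M) (n + 1))) × Fin (3 + 1)) (↥(pbox (towerTorus Lc (fine Lc M) (n + 1))) × Fin (3 + 1)) ℝ}
  (hH₀ : H₀ = (perF (towerTorus Lc (fine Lc M) (n + 1)) (bhKStepSh 3 Lc (Dsh Lc) 0)).submatrix
      (fun b : ↥(pbox (towerTorus Lc (fine Lc M) (n + 1))) × Fin (3 + 1) => ((b.1, Sum.inl b.2) : Idx (towerTorus Lc (fine Lc M) (n + 1)) (Fib 3)))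
      (fun b : ↥(pbox (towerTorus Lc (fine Lc M) (n + 1))) × Fin (3 + 1) => ((b.1, Sum.inl b.2) : Idx (towerTorus Lc (fine Lc M) (n + 1)) (Fib 3))))
  -- THE TABLE LETTER: the road's displayed bi-table IS the pair-symmetrised `ff` block of the row's wound even Wilson bi-stencil `Ŵ₂ᵉ` at the pin table `Pn.T (n+2)` (PART 23)
  (T₂ : ↥(pbox (towerTorus Lc (fine Lc M) (n + 1))) × Fin (3 + 1) → ↥(pbox (towerTorus Lc (fine Lc M) (n + 1))) × Fin (3 + 1) → Matrix (↥(pbox (towerTorus Lc (fine Lc M) (n + 1))) × Fin (3 + 1)) (↥(pbox (towerTorus Lc (fine Lc M) (n + 1))) × Fin (3 + 1)) ℝ)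
  (hT₂ : ∀ b b' : ↥(pbox (towerTorus Lc (fine Lc M) (n + 1))) × Fin (3 + 1), T₂ b b' = (1 / 2 : ℝ) • ((perF (towerTorus Lc (fine Lc M) (n + 1)) (dper (towerTorus Lc (fine Lc M) (n + 1)) (fun X Z i₁ i₂ => ∑' m : Site (3 + 1),
              ((1 / 2 : ℝ) • (wilsonW₂ 3 (Pn.T (n + 1 + 1)) b.2 (b.1 : Site (3 + 1)) b'.2 (translate (towerTorus Lc (fine Lc M) (n + 1)) (b'.1 : Site (3 + 1)) m)
                + sgnK (trK (wilsonW₂ 3 (Pn.T (n + 1 + 1)) b.2 (b.1 : Site (3 + 1)) b'.2 (translate (towerTorus Lc (fine Lc M) (n + 1)) (b'.1 : Site (3 + 1)) m))))) X Z i₁ i₂))).submatrix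
            (fun b : ↥(pbox (towerTorus Lc (fine Lc M) (n + 1))) × Fin (3 + 1) => ((b.1, Sum.inl b.2) : Idx (towerTorus Lc (fine Lc M) (n + 1)) (Fib 3)))
            (fun b : ↥(pbox (towerTorus Lc (fine Lc M) (n + 1))) × Fin (3 + 1) => ((b.1, Sum.inl b.2) : Idx (towerTorus Lc (fine Lc M) (n + 1)) (Fib 3)))
        + (perF (towerTorus Lc (fine Lc M) (n + 1)) (dper (towerTorus Lc (fine Lc M) (n + 1)) (fun X Z i₁ i₂ => ∑' m : Site (3 + 1),
              ((1 / 2 : ℝ) • (wilsonW₂ 3 (Pn.T (n + 1 + 1)) b'.2 (b'.1 : Site (3 + 1)) b.2 (translate (towerTorus Lc (fine Lc M) (n + 1)) (b.1 : Site (3 + 1)) m)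
                + sgnK (trK (wilsonW₂ 3 (Pn.T (n + 1 + 1)) b'.2 (b'.1 : Site (3 + 1)) b.2 (translate (towerTorus Lc (fine Lc M) (n + 1)) (b.1 : Site (3 + 1)) m))))) X Z i₁ i₂))).submatrix
            (fun b : ↥(pbox (towerTorus Lc (fine Lc M) (n + 1))) × Fin (3 + 1) => ((b.1, Sum.inl b.2) : Idx (towerTorus Lc (fine Lc M) (n + 1)) (Fib 3)))
            (fun b : ↥(pbox (towerTorus Lc (fine Lc M) (n + 1))) × Fin (3 + 1) => ((b.1, Sum.inl b.2) : Idx (towerTorus Lc (fine Lc M) (n + 1)) (Fib 3)))))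
  -- (J-X₂): the table's ORDER-2 PURE-GAUGE ROW against `hH₁f`'s cubic Wilson table (displayed; for an1's table the shape of `CombWilsonT2Periodised(K2).torus_H2_pureGauge_*`)
  (hX₂ : ∀ (b : ↥(pbox (towerTorus Lc (fine Lc M) (n + 1))) × Fin (3 + 1)) (lam : ↥(pbox (towerTorus Lc (fine Lc M) (n + 1))) → ℝ),
    ∑ b' : ↥(pbox (towerTorus Lc (fine Lc M) (n + 1))) × Fin (3 + 1), (∑ s : ↥(pbox (towerTorus Lc (fine Lc M) (n + 1))), tgrad (towerTorus Lc (fine Lc M) (n + 1)) (b'.1, Sum.inl b'.2) s * lam s) • T₂ b b'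
      = (1 / 2 : ℝ) • ((perF (towerTorus Lc (fine Lc M) (n + 1)) (dper (towerTorus Lc (fine Lc M) (n + 1)) (wilsonA 3 b.2 (b.1 : Site (3 + 1))))).submatrix
            (fun b : ↥(pbox (towerTorus Lc (fine Lc M) (n + 1))) × Fin (3 + 1) => ((b.1, Sum.inl b.2) : Idx (towerTorus Lc (fine Lc M) (n + 1)) (Fib 3)))
            (fun b : ↥(pbox (towerTorus Lc (fine Lc M) (n + 1))) × Fin (3 + 1) => ((b.1, Sum.inl b.2) : Idx (towerTorus Lc (fine Lc M) (n + 1)) (Fib 3))) * Matrix.diagonal (fun b : ↥(pbox (towerTorus Lc (fine Lc M) (n + 1))) × Fin (3 + 1) => lam b.1)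
        - Matrix.diagonal (fun b : ↥(pbox (towerTorus Lc (fine Lc M) (n + 1))) × Fin (3 + 1) => lam b.1) * (perF (towerTorus Lc (fine Lc M) (n + 1)) (dper (towerTorus Lc (fine Lc M) (n + 1)) (wilsonA 3 b.2 (b.1 : Site (3 + 1))))).submatrix
            (fun b : ↥(pbox (towerTorus Lc (fine Lc M) (n + 1))) × Fin (3 + 1) => ((b.1, Sum.inl b.2) : Idx (towerTorus Lc (fine Lc M) (n + 1)) (Fib 3)))
            (fun b : ↥(pbox (towerTorus Lc (fine Lc M) (n + 1))) × Fin (3 + 1) => ((b.1, Sum.inl b.2) : Idx (towerTorus Lc (fine Lc M) (n + 1)) (Fib 3)))))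
  (Λ₁ : (κ → ℝ) → Matrix (↥(pbox (towerTorus Lc (fine Lc M) (n + 1))) × Fin (3 + 1)) (↥(pbox (towerTorus Lc (fine Lc M) (n + 1))) × Fin (3 + 1)) ℝ)
  (H₁f : (κ → ℝ) → Matrix (↥(pbox (towerTorus Lc (fine Lc M) (n + 1))) × Fin (3 + 1)) (↥(pbox (towerTorus Lc (fine Lc M) (n + 1))) × Fin (3 + 1)) ℝ)
  (hH₁ : ∀ v, H₁f v = (-2 * c) • ∑ b : ↥(pbox (towerTorus Lc (fine Lc M) (n + 1))) × Fin (3 + 1), hv v b •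
        (perF (towerTorus Lc (fine Lc M) (n + 1)) (dper (towerTorus Lc (fine Lc M) (n + 1)) (wilsonA 3 b.2 (b.1 : Site (3 + 1))))).submatrix
            (fun b : ↥(pbox (towerTorus Lc (fine Lc M) (n + 1))) × Fin (3 + 1) => ((b.1, Sum.inl b.2) : Idx (towerTorus Lc (fine Lc M) (n + 1)) (Fib 3)))
            (fun b : ↥(pbox (towerTorus Lc (fine Lc M) (n + 1))) × Fin (3 + 1) => ((b.1, Sum.inl b.2) : Idx (towerTorus Lc (fine Lc M) (n + 1)) (Fib 3)))
      + Λ₁ v)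
  (Λ₂ : (κ → ℝ) → (κ → ℝ) → Matrix (↥(pbox (towerTorus Lc (fine Lc M) (n + 1))) × Fin (3 + 1)) (↥(pbox (towerTorus Lc (fine Lc M) (n + 1))) × Fin (3 + 1)) ℝ)
  (H₂f : (κ → ℝ) → (κ → ℝ) → Matrix (↥(pbox (towerTorus Lc (fine Lc M) (n + 1))) × Fin (3 + 1)) (↥(pbox (towerTorus Lc (fine Lc M) (n + 1))) × Fin (3 + 1)) ℝ)
  (hH₂ : ∀ v v', (1 / 2 : ℝ) • (H₂f v v' + H₂f v' v)
    = (-2 * c) ^ 2 • ∑ b : ↥(pbox (towerTorus Lc (fine Lc M) (n + 1))) × Fin (3 + 1), ∑ b' : ↥(pbox (towerTorus Lc (fine Lc M) (n + 1))) × Fin (3 + 1), (hv v b * hv v' b') • T₂ b b' + Λ₂ v v')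
  (H'₂f : (κ → ℝ) → (κ → ℝ) → Matrix (↥(pbox (towerTorus Lc (fine Lc M) (n + 1))) × Fin (3 + 1)) (↥(pbox (towerTorus Lc (fine Lc M) (n + 1))) × Fin (3 + 1)) ℝ)
  (hH'₂f : ∀ v v', H'₂f v v' = ((-(c • Matrix.diagonal (fun b : (↥(pbox (towerTorus Lc (fine Lc M) (n + 1))) × Fin (3 + 1)) => lv v b.1))) * (-(c • Matrix.diagonal (fun b : (↥(pbox (towerTorus Lc (fine Lc M) (n + 1))) × Fin (3 + 1)) => lv v' b.1))))ᵀ * H₀ + (-((-(c • Matrix.diagonal (fun b : (↥(pbox (towerTorus Lc (fine Lc M) (n + 1))) × Fin (3 + 1)) => lv v b.1)))ᵀ * H₁f v') + -((-(c • Matrix.diagonal (fun b : (↥(pbox (towerTorus Lc (fine Lc M) (n + 1))) × Fin (3 + 1)) => lv v b.1)))ᵀ * H₀ * (-(c • Matrix.diagonal (fun b : (↥(pbox (towerTorus Lc (fine Lc M) (n + 1))) × Fin (3 + 1)) => lv v' b.1)))))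
    + ((-((-(c • Matrix.diagonal (fun b : (↥(pbox (towerTorus Lc (fine Lc M) (n + 1))) × Fin (3 + 1)) => lv v b.1)))ᵀ * H₁f v') + -((-(c • Matrix.diagonal (fun b : (↥(pbox (towerTorus Lc (fine Lc M) (n + 1))) × Fin (3 + 1)) => lv v b.1)))ᵀ * H₀ * (-(c • Matrix.diagonal (fun b : (↥(pbox (towerTorus Lc (fine Lc M) (n + 1))) × Fin (3 + 1)) => lv v' b.1))))) + (H₂f v v' + H₁f v * (-(c • Matrix.diagonal (fun b : (↥(pbox (towerTorus Lc (fine Lc M) (n + 1))) × Fin (3 + 1)) => lv v' b.1))) + (H₁f v * (-(c • Matrix.diagonal (fun b : (↥(pbox (towerTorus Lc (fine Lc M) (n + 1))) × Fin (3 + 1)) => lv v' b.1))) + H₀ * ((-(c • Matrix.diagonal (fun b : (↥(pbox (towerTorus Lc (fine Lc M) (n + 1))) × Fin (3 + 1)) => lv v b.1))) * (-(c • Matrix.diagonal (fun b : (↥(pbox (towerTorus Lc (fine Lc M) (n + 1))) × Fin (3 + 1)) => lv v' b.1))))))))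
  (r : ℝ) (hr : (-2 * c) * r = Pn.cE (n + 1 + 1)) (a a' : κ)
  -- THE SECOND-ORDER H-SIDE LOCK ROW on the free pins `Pn.cE ∕ Pn.cE₂ (n+2)` (road A-1 l.67863)
  (hcE₂ : (Pn.cE (n + 1 + 1)) ^ 2 = Pn.cE₂ (n + 1 + 1))
  -- (J-Λ₂): the remainder of #7 against PART 23's two MIXED words, entrywise (displayed; Q-FP-45-1)
  (hJΛ₂ : ∀ (p q : ↥(pbox (towerTorus Lc (fine Lc M) (n + 1)))) (α β : Fin (3 + 1)),
    (Λ₂ (r • (Pi.single a (1 : ℝ) : κ → ℝ)) (r • (Pi.single a' (1 : ℝ) : κ → ℝ))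
            + c • (Matrix.diagonal (fun b : ↥(pbox (towerTorus Lc (fine Lc M) (n + 1))) × Fin (3 + 1) => lv (r • (Pi.single a (1 : ℝ) : κ → ℝ)) b.1) * Λ₁ (r • (Pi.single a' (1 : ℝ) : κ → ℝ))
              - Λ₁ (r • (Pi.single a' (1 : ℝ) : κ → ℝ)) * Matrix.diagonal (fun b : ↥(pbox (towerTorus Lc (fine Lc M) (n + 1))) × Fin (3 + 1) => lv (r • (Pi.single a (1 : ℝ) : κ → ℝ)) b.1)
              + (Matrix.diagonal (fun b : ↥(pbox (towerTorus Lc (fine Lc M) (n + 1))) × Fin (3 + 1) => lv (r • (Pi.single a' (1 : ℝ) : κ → ℝ)) b.1) * Λ₁ (r • (Pi.single a (1 : ℝ) : κ → ℝ))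
                - Λ₁ (r • (Pi.single a (1 : ℝ) : κ → ℝ)) * Matrix.diagonal (fun b : ↥(pbox (towerTorus Lc (fine Lc M) (n + 1))) × Fin (3 + 1) => lv (r • (Pi.single a' (1 : ℝ) : κ → ℝ)) b.1)))) (p, α) (q, β)
      = (∑ u : ↥(pbox (towerTorus Lc (fine Lc M) (n + 1))), ∑ κ : Fin (3 + 1), ∑ w : ↥(pbox M), ∑ ρ : Fin (3 + 1),
          perF (towerTorus Lc (fine Lc M) (n + 1)) A (u, Sum.inl κ) (wrapPt (towerTorus Lc (fine Lc M) (n + 1)) (((Lc ^ (n + 1 + 1) : ℕ) : ℤ) • yN a), Sum.inr (μN a))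
            * (perF (towerTorus Lc (fine Lc M) (n + 1)) A (wrapPt (towerTorus Lc (fine Lc M) (n + 1)) (((Lc ^ (n + 1 + 1) : ℕ) : ℤ) • (w : Site (3 + 1))), Sum.inr ρ) (wrapPt (towerTorus Lc (fine Lc M) (n + 1)) (((Lc ^ (n + 1 + 1) : ℕ) : ℤ) • yN a'), Sum.inr (μN a'))
                * perF (towerTorus Lc (fine Lc M) (n + 1)) (dper (towerTorus Lc (fine Lc M) (n + 1)) (fun X Z i₁ i₂ => ∑' m : Site (3 + 1),
            ((1 / 2 : ℝ) • (M2Of 3 (Lc ^ (n + 1 + 1)) (tabsCompG (n + 1 + 1) (one_le_of_neZero Lc) (Roots.ctr Lc).hr (Pn.cM (n + 1 + 1))).mixFF 0 κ (u : Site (3 + 1)) ρ (translate M (w : Site (3 + 1)) m) + sgnK (trK (M2Of 3 (Lc ^ (n + 1 + 1)) (tabsCompG (n + 1 + 1) (one_le_of_neZero Lc) (Roots.ctr Lc).hr (Pn.cM (n + 1 + 1))).mixFF 0 κ (u : Site (3 + 1)) ρ (translate M (w : Site (3 + 1)) m))))) X Z i₁ i₂)) (p, Sum.inl α) (q, Sum.inl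 β)))
          + (∑ u : ↥(pbox (towerTorus Lc (fine Lc M) (n + 1))), ∑ κ : Fin (3 + 1), ∑ w : ↥(pbox M), ∑ ρ : Fin (3 + 1),
          perF (towerTorus Lc (fine Lc M) (n + 1)) A (u, Sum.inl κ) (wrapPt (towerTorus Lc (fine Lc M) (n + 1)) (((Lc ^ (n + 1 + 1) : ℕ) : ℤ) • yN a'), Sum.inr (μN a'))
            * (perF (towerTorus Lc (fine Lc M) (n + 1)) A (wrapPt (towerTorus Lc (fine Lc M) (n + 1)) (((Lc ^ (n + 1 + 1) : ℕ) : ℤ) • (w : Site (3 + 1))), Sum.inr ρ) (wrapPt (towerTorus Lc (fine Lc M) (n + 1)) (((Lc ^ (n + 1 + 1) : ℕ) : ℤ) • yN a), Sum.inr (μN a))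
                * perF (towerTorus Lc (fine Lc M) (n + 1)) (dper (towerTorus Lc (fine Lc M) (n + 1)) (fun X Z i₁ i₂ => ∑' m : Site (3 + 1),
            ((1 / 2 : ℝ) • (M2Of 3 (Lc ^ (n + 1 + 1)) (tabsCompG (n + 1 + 1) (one_le_of_neZero Lc) (Roots.ctr Lc).hr (Pn.cM (n + 1 + 1))).mixFF 0 κ (u : Site (3 + 1)) ρ (translate M (w : Site (3 + 1)) m) + sgnK (trK (M2Of 3 (Lc ^ (n + 1 + 1)) (tabsCompG (n + 1 + 1) (one_le_of_neZero Lc) (Roots.ctr Lc).hr (Pn.cM (n + 1 + 1))).mixFF 0 κ (u : Site (3 + 1)) ρ (translate M (w : Site (3 + 1)) m))))) X Z i₁ i₂)) (p, Sum.inl α) (q, Sum.inl β))))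

include hhvl hlv hJW hH₀ hT₂ hX₂ hH₁ hH₂ hH'₂f hr hcE₂ hJΛ₂ in
/-- [folklore] **`hHN2_of_locks_of_junctions_of_reading` — v5's ROW `hHN₂` AT THE LABEL PAIR `(μN a, yN a; μN a′, yN a′)`, PER BOX, FROM THE ROAD's DATA AND A DISPLAYED READING**:
for #7's letters, the table letter `hT₂`, a displayed torus reading `hWNff` of the wound even N-family's `ff` block (the row's PART 23 §4, in its exact shape), the lock `hcE₂`
and the junction rows (J-X₂) `hX₂`, (J-Λ₂) `hJΛ₂`:
`½•(H′₂f (r•e_a) (r•e_{a′}) + H′₂f (r•e_{a′}) (r•e_a)) = (perF T (dper T (x w ↦ Σ'_e WN♮ (μN a) (yN a) (μN a′) (translate M (yN a′) e) x w)))|ff`. -/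
theorem hHN2_of_locks_of_junctions_of_readingAG
    (hWNff : ∀ (p q : ↥(pbox (towerTorus Lc (fine Lc M) (n + 1)))) (α β : Fin (3 + 1)),
      perF (towerTorus Lc (fine Lc M) (n + 1)) (dper (towerTorus Lc (fine Lc M) (n + 1))
          (fun X Z i₁ i₂ => ∑' e : Site (3 + 1), ((1 / 2 : ℝ) • (WN (Roots.ctr Lc) Pn (n + 1) (μN a) (yN a) (μN a') (translate M (yN a') e)
            + sgnK (trK (WN (Roots.ctr Lc) Pn (n + 1) (μN a) (yN a) (μN a') (translate M (yN a') e))))) X Z i₁ i₂)) (p, Sum.inl α) (q, Sum.inl β)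
      = Pn.cE₂ (n + 1 + 1) * ((1 / 2 : ℝ) * ((∑ u : ↥(pbox (towerTorus Lc (fine Lc M) (n + 1))), ∑ κ : Fin (3 + 1), ∑ u' : ↥(pbox (towerTorus Lc (fine Lc M) (n + 1))), ∑ κ' : Fin (3 + 1),
          perF (towerTorus Lc (fine Lc M) (n + 1)) A (u, Sum.inl κ) (wrapPt (towerTorus Lc (fine Lc M) (n + 1)) (((Lc ^ (n + 1 + 1) : ℕ) : ℤ) • yN a), Sum.inr (μN a))
            * (perF (towerTorus Lc (fine Lc M) (n + 1)) A (u', Sum.inl κ') (wrapPt (towerTorus Lc (fine Lc M) (n + 1)) (((Lc ^ (n + 1 + 1) : ℕ) : ℤ) • yN a'), Sum.inr (μN a'))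
                * perF (towerTorus Lc (fine Lc M) (n + 1)) (dper (towerTorus Lc (fine Lc M) (n + 1)) (fun X Z i₁ i₂ => ∑' m : Site (3 + 1),
            ((1 / 2 : ℝ) • (wilsonW₂ 3 (Pn.T (n + 1 + 1)) κ (u : Site (3 + 1)) κ' (translate (towerTorus Lc (fine Lc M) (n + 1)) (u' : Site (3 + 1)) m) + sgnK (trK (wilsonW₂ 3 (Pn.T (n + 1 + 1)) κ (u : Site (3 + 1)) κ' (translate (towerTorus Lc (fine Lc M) (n + 1)) (u' : Site (3 + 1)) m))))) X Z i₁ i₂)) (p, Sum.inl α) (q, Sum.inl β)))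
          + (∑ u : ↥(pbox (towerTorus Lc (fine Lc M) (n + 1))), ∑ κ : Fin (3 + 1), ∑ u' : ↥(pbox (towerTorus Lc (fine Lc M) (n + 1))), ∑ κ' : Fin (3 + 1),
          perF (towerTorus Lc (fine Lc M) (n + 1)) A (u, Sum.inl κ) (wrapPt (towerTorus Lc (fine Lc M) (n + 1)) (((Lc ^ (n + 1 + 1) : ℕ) : ℤ) • yN a'), Sum.inr (μN a'))
            * (perF (towerTorus Lc (fine Lc M) (n + 1)) A (u', Sum.inl κ') (wrapPt (towerTorus Lc (fine Lc M) (n + 1)) (((Lc ^ (n + 1 + 1) : ℕ) : ℤ) • yN a), Sum.inr (μN a))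
                * perF (towerTorus Lc (fine Lc M) (n + 1)) (dper (towerTorus Lc (fine Lc M) (n + 1)) (fun X Z i₁ i₂ => ∑' m : Site (3 + 1),
            ((1 / 2 : ℝ) • (wilsonW₂ 3 (Pn.T (n + 1 + 1)) κ (u : Site (3 + 1)) κ' (translate (towerTorus Lc (fine Lc M) (n + 1)) (u' : Site (3 + 1)) m) + sgnK (trK (wilsonW₂ 3 (Pn.T (n + 1 + 1)) κ (u : Site (3 + 1)) κ' (translate (towerTorus Lc (fine Lc M) (n + 1)) (u' : Site (3 + 1)) m))))) X Z i₁ i₂)) (p, Sum.inl α) (q, Sum.inl β)))))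
        + ((∑ u : ↥(pbox (towerTorus Lc (fine Lc M) (n + 1))), ∑ κ : Fin (3 + 1), ∑ w : ↥(pbox M), ∑ ρ : Fin (3 + 1),
          perF (towerTorus Lc (fine Lc M) (n + 1)) A (u, Sum.inl κ) (wrapPt (towerTorus Lc (fine Lc M) (n + 1)) (((Lc ^ (n + 1 + 1) : ℕ) : ℤ) • yN a), Sum.inr (μN a))
            * (perF (towerTorus Lc (fine Lc M) (n + 1)) A (wrapPt (towerTorus Lc (fine Lc M) (n + 1)) (((Lc ^ (n + 1 + 1) : ℕ) : ℤ) • (w : Site (3 + 1))), Sum.inr ρ) (wrapPt (towerTorus Lc (fine Lc M) (n + 1)) (((Lc ^ (n + 1 + 1) : ℕ) : ℤ) • yN a'), Sum.inr (μN a'))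
                * perF (towerTorus Lc (fine Lc M) (n + 1)) (dper (towerTorus Lc (fine Lc M) (n + 1)) (fun X Z i₁ i₂ => ∑' m : Site (3 + 1),
            ((1 / 2 : ℝ) • (M2Of 3 (Lc ^ (n + 1 + 1)) (tabsCompG (n + 1 + 1) (one_le_of_neZero Lc) (Roots.ctr Lc).hr (Pn.cM (n + 1 + 1))).mixFF 0 κ (u : Site (3 + 1)) ρ (translate M (w : Site (3 + 1)) m) + sgnK (trK (M2Of 3 (Lc ^ (n + 1 + 1)) (tabsCompG (n + 1 + 1) (one_le_of_neZero Lc) (Roots.ctr Lc).hr (Pn.cM (n + 1 + 1))).mixFF 0 κ (u : Site (3 + 1)) ρ (translate M (w : Site (3 + 1)) m))))) X Z i₁ i₂)) (p, Sum.inl α) (q, Sum.inl β)))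
          + (∑ u : ↥(pbox (towerTorus Lc (fine Lc M) (n + 1))), ∑ κ : Fin (3 + 1), ∑ w : ↥(pbox M), ∑ ρ : Fin (3 + 1),
          perF (towerTorus Lc (fine Lc M) (n + 1)) A (u, Sum.inl κ) (wrapPt (towerTorus Lc (fine Lc M) (n + 1)) (((Lc ^ (n + 1 + 1) : ℕ) : ℤ) • yN a'), Sum.inr (μN a'))
            * (perF (towerTorus Lc (fine Lc M) (n + 1)) A (wrapPt (towerTorus Lc (fine Lc M) (n + 1)) (((Lc ^ (n + 1 + 1) : ℕ) : ℤ) • (w : Site (3 + 1))), Sum.inr ρ) (wrapPt (towerTorus Lc (fine Lc M) (n + 1)) (((Lc ^ (n + 1 + 1) : ℕ) : ℤ) • yN a), Sum.inr (μN a))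
                * perF (towerTorus Lc (fine Lc M) (n + 1)) (dper (towerTorus Lc (fine Lc M) (n + 1)) (fun X Z i₁ i₂ => ∑' m : Site (3 + 1),
            ((1 / 2 : ℝ) • (M2Of 3 (Lc ^ (n + 1 + 1)) (tabsCompG (n + 1 + 1) (one_le_of_neZero Lc) (Roots.ctr Lc).hr (Pn.cM (n + 1 + 1))).mixFF 0 κ (u : Site (3 + 1)) ρ (translate M (w : Site (3 + 1)) m) + sgnK (trK (M2Of 3 (Lc ^ (n + 1 + 1)) (tabsCompG (n + 1 + 1) (one_le_of_neZero Lc) (Roots.ctr Lc).hr (Pn.cM (n + 1 + 1))).mixFF 0 κ (u : Site (3 + 1)) ρ (translate M (w : Site (3 + 1)) m))))) X Z i₁ i₂)) (p, Sum.inl α) (q, Sum.inl β))))) :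
    (1 / 2 : ℝ) • (H'₂f (r • (Pi.single a (1 : ℝ) : κ → ℝ)) (r • (Pi.single a' (1 : ℝ) : κ → ℝ))
          + H'₂f (r • (Pi.single a' (1 : ℝ) : κ → ℝ)) (r • (Pi.single a (1 : ℝ) : κ → ℝ)))
      = (perF (towerTorus Lc (fine Lc M) (n + 1)) (dper (towerTorus Lc (fine Lc M) (n + 1))
          (fun X Z i₁ i₂ => ∑' e : Site (3 + 1), ((1 / 2 : ℝ) • (WN (Roots.ctr Lc) Pn (n + 1) (μN a) (yN a) (μN a') (translate M (yN a') e)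
            + sgnK (trK (WN (Roots.ctr Lc) Pn (n + 1) (μN a) (yN a) (μN a') (translate M (yN a') e))))) X Z i₁ i₂))).submatrix
          (fun b : ↥(pbox (towerTorus Lc (fine Lc M) (n + 1))) × Fin (3 + 1) => ((b.1, Sum.inl b.2) : Idx (towerTorus Lc (fine Lc M) (n + 1)) (Fib 3)))
          (fun b : ↥(pbox (towerTorus Lc (fine Lc M) (n + 1))) × Fin (3 + 1) => ((b.1, Sum.inl b.2) : Idx (towerTorus Lc (fine Lc M) (n + 1)) (Fib 3))) := by
  have hTs : ∀ b b' : ↥(pbox (towerTorus Lc (fine Lc M) (n + 1))) × Fin (3 + 1), T₂ b b' = T₂ b' b := fun b b' => by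
    rw [hT₂, hT₂]; exact congrArg ((1 / 2 : ℝ) • ·) (add_comm _ _)
  refine Matrix.ext fun P Q => ?_
  obtain ⟨p, α⟩ := P
  obtain ⟨q, β⟩ := Q
  rw [Hprime2_symm_eq_sq_smul_bivertex_cols_add_remA M n c A Pn yN μN hv hhvl lv hlv hJW hH₀ T₂ hTs hX₂ Λ₁ H₁f hH₁ Λ₂ H₂f hH₂ H'₂f hH'₂f r hr a a',
    Matrix.add_apply, hJΛ₂ p q α β, Matrix.submatrix_apply, hWNff p q α β, ← hcE₂, Matrix.smul_apply, smul_eq_mul]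
  congr 1
  congr 1
  simp only [Matrix.sum_apply, Matrix.smul_apply, smul_eq_mul, hT₂, Matrix.add_apply, Matrix.submatrix_apply]
  rw [sum_sum_mul_half_symm]
  simp only [Fintype.sum_prod_type]



end RowHR

end Summit.QuantumFields.BalabanUV.Beta.FP.TowerHN2ReadersChartGenericG.HN2Row

namespace Summit.QuantumFields.BalabanUV.Beta.FP.TowerHN2ReadersChartGenericG.MixedDoor


open Finset Matrix

open Finset Matrix
open Literature.MathematicalPhysics.QuantumFieldTheory
open Literature.MathematicalPhysics.QuantumFieldTheory.Balaban1983to89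
open Literature.MathematicalPhysics.QuantumFieldTheory.Balaban1983to89.Beta
open B4TorusKernel.MultiPeriod (translate)
open B5Prop11Plancherel (fine)
open B6Lemma24Torus (pbox)
open AffineAveraging (Site box toSite)
open AveragingContoursRooted (ctr ctrOff)
open OneStepResolventKernel (Fib)
open StepJetData (wilsonA)
open WilsonBiStencil (wilsonW₂)
open BalabanStepW2 (M2Of)
open Summit.QuantumFields.BalabanUV.Beta.TameKernelCalculus (trK)
open Summit.QuantumFields.BalabanUV.Beta.BorderedHessian (sgnK)
open Summit.QuantumFields.BalabanUV.Beta.SymShiftedSpread (bhKStepSh)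
open Summit.QuantumFields.BalabanUV.Beta.DshAn1 (Dsh)
open Summit.QuantumFields.BalabanUV.Beta.AxialDressingRooted (one_le_of_neZero)
open Summit.QuantumFields.BalabanUV.Beta.CompositeOneShotJetsGraded (tabsCompG)
open Summit.QuantumFields.BalabanUV.Beta.CompositeOneShotJetData (Roots Pins AN WN)
open Summit.QuantumFields.BalabanUV.Beta.FP.KernelPeriodisationFib (Idx perF)
open Summit.QuantumFields.BalabanUV.Beta.FP.KernelPeriodisationFibLoc (dper)
open Summit.QuantumFields.BalabanUV.Beta.FP.TorusGaugeCovariance (tgrad)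
open Summit.QuantumFields.BalabanUV.Beta.FP.TorusGaugeCovariancePairing (wrapPt)
open Summit.QuantumFields.BalabanUV.Beta.FP.TorusCompositeObjects (towerTorus)
open Summit.QuantumFields.BalabanUV.Beta.FP.TowerHN1Row (map_smul_of_linear)

open Summit.QuantumFields.BalabanUV.Beta.FP.TowerHN2RowMixed (mixed_lock_combine)

open Summit.QuantumFields.BalabanUV.Beta.FP.TowerHN2RowMixedDoor (commutator_pair_of_wardRow_door)
open Summit.QuantumFields.BalabanUV.Beta.FP.TowerN1ReadersChartGeneric (direction_add_exact_eq_smul_colA)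
open ExpKernelCalculus (MKer)



/- R-C15's `hJΛ2'_of_wardRow_doorA` (section `RowMD`) displays no table word and is NOT twinned: S-END-G opens R-C15's original by name (gate `dedup.landed`). -/

section MixedMD

variable {Lc : ℕ} [NeZero Lc] (M : Fin (3 + 1) → ℕ) [∀ μ, NeZero (M μ)] (n : ℕ) (c : ℝ) (Pn : Pins) (A : MKer (3 + 1) (Fib 3))
  {κ : Type*} [DecidableEq κ] (yN : κ → Site (3 + 1)) (μN : κ → Fin (3 + 1))
  (hv : (κ → ℝ) → (↥(pbox (towerTorus Lc (fine Lc M) (n + 1))) × Fin (3 + 1) → ℝ))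
  (hhvl : ∀ (r : ℝ) (x y : κ → ℝ), hv (r • x + y) = r • hv x + hv y)
  (lv : (κ → ℝ) → (↥(pbox (towerTorus Lc (fine Lc M) (n + 1))) → ℝ))
  (hlv : ∀ (r : ℝ) (x y : κ → ℝ), lv (r • x + y) = r • lv x + lv y)
  (hJW : ∀ (a : κ) (b : ↥(pbox (towerTorus Lc (fine Lc M) (n + 1))) × Fin (3 + 1)), hv (Pi.single a 1) b
      = perF (towerTorus Lc (fine Lc M) (n + 1)) A (b.1, Sum.inl b.2)
          (wrapPt (towerTorus Lc (fine Lc M) (n + 1)) (((Lc ^ (n + 1 + 1) : ℕ) : ℤ) • yN a), Sum.inr (μN a))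
        - ∑ s : ↥(pbox (towerTorus Lc (fine Lc M) (n + 1))), tgrad (towerTorus Lc (fine Lc M) (n + 1)) (b.1, Sum.inl b.2) s * lv (Pi.single a 1) s)
  -- THE MULTIPLIER-COLUMN FAMILY `hm` (linear) with its junction letter `hJM`: the source `e_a`'s coarse multiplier weights are the `Ŝ`-column of PART 23
  (hm : (κ → ℝ) → (↥(pbox M) × Fin (3 + 1) → ℝ))
  (hml : ∀ (r : ℝ) (x y : κ → ℝ), hm (r • x + y) = r • hm x + hm y)
  (hJM : ∀ (a : κ) (β : ↥(pbox M) × Fin (3 + 1)), hm (Pi.single a 1) β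
      = perF (towerTorus Lc (fine Lc M) (n + 1)) A (wrapPt (towerTorus Lc (fine Lc M) (n + 1)) (((Lc ^ (n + 1 + 1) : ℕ) : ℤ) • (β.1 : Site (3 + 1))), Sum.inr β.2)
              (wrapPt (towerTorus Lc (fine Lc M) (n + 1)) (((Lc ^ (n + 1 + 1) : ℕ) : ℤ) • yN a), Sum.inr (μN a)))
  -- THE MIXED TABLE LETTER: the row's wound even mixed table `ℳ̂₂ᵉ` (PART 23), fine field bond `b`, coarse multiplier bond `β`, `ff` block
  (M₂ : ↥(pbox (towerTorus Lc (fine Lc M) (n + 1))) × Fin (3 + 1) → ↥(pbox M) × Fin (3 + 1) → Matrix (↥(pbox (towerTorus Lc (fine Lc M) (n + 1))) × Fin (3 + 1)) (↥(pbox (towerTorus Lc (fine Lc M) (n + 1))) × Fin (3 + 1)) ℝ)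
  (hM₂ : ∀ (b : ↥(pbox (towerTorus Lc (fine Lc M) (n + 1))) × Fin (3 + 1)) (β : ↥(pbox M) × Fin (3 + 1)), M₂ b β = (perF (towerTorus Lc (fine Lc M) (n + 1)) (dper (towerTorus Lc (fine Lc M) (n + 1)) (fun X Z i₁ i₂ => ∑' m : Site (3 + 1),
              ((1 / 2 : ℝ) • (M2Of 3 (Lc ^ (n + 1 + 1)) (tabsCompG (n + 1 + 1) (one_le_of_neZero Lc) (Roots.ctr Lc).hr (Pn.cM (n + 1 + 1))).mixFF 0 b.2 (b.1 : Site (3 + 1)) β.2 (translate M (β.1 : Site (3 + 1)) m)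
                + sgnK (trK (M2Of 3 (Lc ^ (n + 1 + 1)) (tabsCompG (n + 1 + 1) (one_le_of_neZero Lc) (Roots.ctr Lc).hr (Pn.cM (n + 1 + 1))).mixFF 0 b.2 (b.1 : Site (3 + 1)) β.2 (translate M (β.1 : Site (3 + 1)) m))))) X Z i₁ i₂))).submatrix
            (fun b : ↥(pbox (towerTorus Lc (fine Lc M) (n + 1))) × Fin (3 + 1) => ((b.1, Sum.inl b.2) : Idx (towerTorus Lc (fine Lc M) (n + 1)) (Fib 3)))
            (fun b : ↥(pbox (towerTorus Lc (fine Lc M) (n + 1))) × Fin (3 + 1) => ((b.1, Sum.inl b.2) : Idx (towerTorus Lc (fine Lc M) (n + 1)) (Fib 3))))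
  -- THE DISPLAY of #7's remainder `Λ₂` as the MIXED SECTOR with weight `cM₂`
  (Λ₁ : (κ → ℝ) → Matrix (↥(pbox (towerTorus Lc (fine Lc M) (n + 1))) × Fin (3 + 1)) (↥(pbox (towerTorus Lc (fine Lc M) (n + 1))) × Fin (3 + 1)) ℝ)
  (Λ₂ : (κ → ℝ) → (κ → ℝ) → Matrix (↥(pbox (towerTorus Lc (fine Lc M) (n + 1))) × Fin (3 + 1)) (↥(pbox (towerTorus Lc (fine Lc M) (n + 1))) × Fin (3 + 1)) ℝ) (cM₂ : ℝ)
  (hΛ₂ : ∀ v v', Λ₂ v v' = cM₂ • ∑ b : ↥(pbox (towerTorus Lc (fine Lc M) (n + 1))) × Fin (3 + 1), ∑ β : ↥(pbox M) × Fin (3 + 1), (hv v b * hm v' β + hv v' b * hm v β) • M₂ b β)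
  (r : ℝ) (a a' : κ)
  -- THE MIXED LOCK ROW and THE RESIDUAL GAUGE ROW (J-Λ₂′)
  (hcM₂ : cM₂ * r * r = 1)
  -- THE DOOR (v10): (J-Λ₂′) with the door-valued residual row moved right (`TowerHN2RowMixedDoor.hJΛ2'_of_wardRow_door`'s conclusion)
  (D : Matrix (↥(pbox (towerTorus Lc (fine Lc M) (n + 1))) × Fin (3 + 1)) (↥(pbox (towerTorus Lc (fine Lc M) (n + 1))) × Fin (3 + 1)) ℝ)
  (hJΛ₂' : c • (Matrix.diagonal (fun b : ↥(pbox (towerTorus Lc (fine Lc M) (n + 1))) × Fin (3 + 1) => lv (r • (Pi.single a (1 : ℝ) : κ → ℝ)) b.1) * Λ₁ (r • (Pi.single a' (1 : ℝ) : κ → ℝ))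
              - Λ₁ (r • (Pi.single a' (1 : ℝ) : κ → ℝ)) * Matrix.diagonal (fun b : ↥(pbox (towerTorus Lc (fine Lc M) (n + 1))) × Fin (3 + 1) => lv (r • (Pi.single a (1 : ℝ) : κ → ℝ)) b.1)
              + (Matrix.diagonal (fun b : ↥(pbox (towerTorus Lc (fine Lc M) (n + 1))) × Fin (3 + 1) => lv (r • (Pi.single a' (1 : ℝ) : κ → ℝ)) b.1) * Λ₁ (r • (Pi.single a (1 : ℝ) : κ → ℝ))
                - Λ₁ (r • (Pi.single a (1 : ℝ) : κ → ℝ)) * Matrix.diagonal (fun b : ↥(pbox (towerTorus Lc (fine Lc M) (n + 1))) × Fin (3 + 1) => lv (r • (Pi.single a' (1 : ℝ) : κ → ℝ)) b.1)))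
      = (cM₂ * r) • ∑ b : ↥(pbox (towerTorus Lc (fine Lc M) (n + 1))) × Fin (3 + 1), ∑ β : ↥(pbox M) × Fin (3 + 1),
          ((∑ s : ↥(pbox (towerTorus Lc (fine Lc M) (n + 1))), tgrad (towerTorus Lc (fine Lc M) (n + 1)) (b.1, Sum.inl b.2) s * lv (r • (Pi.single a (1 : ℝ) : κ → ℝ)) s)
              * perF (towerTorus Lc (fine Lc M) (n + 1)) A (wrapPt (towerTorus Lc (fine Lc M) (n + 1)) (((Lc ^ (n + 1 + 1) : ℕ) : ℤ) • (β.1 : Site (3 + 1))), Sum.inr β.2)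
              (wrapPt (towerTorus Lc (fine Lc M) (n + 1)) (((Lc ^ (n + 1 + 1) : ℕ) : ℤ) • yN a'), Sum.inr (μN a'))
            + (∑ s : ↥(pbox (towerTorus Lc (fine Lc M) (n + 1))), tgrad (towerTorus Lc (fine Lc M) (n + 1)) (b.1, Sum.inl b.2) s * lv (r • (Pi.single a' (1 : ℝ) : κ → ℝ)) s)
              * perF (towerTorus Lc (fine Lc M) (n + 1)) A (wrapPt (towerTorus Lc (fine Lc M) (n + 1)) (((Lc ^ (n + 1 + 1) : ℕ) : ℤ) • (β.1 : Site (3 + 1))), Sum.inr β.2)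
              (wrapPt (towerTorus Lc (fine Lc M) (n + 1)) (((Lc ^ (n + 1 + 1) : ℕ) : ℤ) • yN a), Sum.inr (μN a))) • M₂ b β
        - (cM₂ * r) • D)

include hhvl hlv hJW hml hJM hM₂ hΛ₂ hcM₂ hJΛ₂' in
/-- [folklore] **`hJΛ2_of_mixedLock_of_mixedGauge_door` — (J-Λ₂) FROM THE MIXED DISPLAY, THE LOCK `hcM₂` AND (J-Λ₂′)−door**: at `(a, a′)`, for every entry,
`(Λ₂ (r•e_a) (r•e_{a′}) + c•([E_a, Λ₁(r•e_{a′})] + [E_{a′}, Λ₁(r•e_a)])) (p,α) (q,β)` = PART 23 §4's two mixed words `+ (−(cM₂·r) • D) (p,α) (q,β)` (`mixed_lock_combine` BY NAME). -/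
theorem hJΛ2_of_mixedLock_of_mixedGauge_doorAG (p q : ↥(pbox (towerTorus Lc (fine Lc M) (n + 1)))) (α β : Fin (3 + 1)) :
    (Λ₂ (r • (Pi.single a (1 : ℝ) : κ → ℝ)) (r • (Pi.single a' (1 : ℝ) : κ → ℝ))
            + c • (Matrix.diagonal (fun b : ↥(pbox (towerTorus Lc (fine Lc M) (n + 1))) × Fin (3 + 1) => lv (r • (Pi.single a (1 : ℝ) : κ → ℝ)) b.1) * Λ₁ (r • (Pi.single a' (1 : ℝ) : κ → ℝ))
              - Λ₁ (r • (Pi.single a' (1 : ℝ) : κ → ℝ)) * Matrix.diagonal (fun b : ↥(pbox (towerTorus Lc (fine Lc M) (n + 1))) × Fin (3 + 1) => lv (r • (Pi.single a (1 : ℝ) : κ → ℝ)) b.1)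
              + (Matrix.diagonal (fun b : ↥(pbox (towerTorus Lc (fine Lc M) (n + 1))) × Fin (3 + 1) => lv (r • (Pi.single a' (1 : ℝ) : κ → ℝ)) b.1) * Λ₁ (r • (Pi.single a (1 : ℝ) : κ → ℝ))
                - Λ₁ (r • (Pi.single a (1 : ℝ) : κ → ℝ)) * Matrix.diagonal (fun b : ↥(pbox (towerTorus Lc (fine Lc M) (n + 1))) × Fin (3 + 1) => lv (r • (Pi.single a' (1 : ℝ) : κ → ℝ)) b.1)))) (p, α) (q, β)
      = (∑ u : ↥(pbox (towerTorus Lc (fine Lc M) (n + 1))), ∑ κ : Fin (3 + 1), ∑ w : ↥(pbox M), ∑ ρ : Fin (3 + 1),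
          perF (towerTorus Lc (fine Lc M) (n + 1)) A (u, Sum.inl κ) (wrapPt (towerTorus Lc (fine Lc M) (n + 1)) (((Lc ^ (n + 1 + 1) : ℕ) : ℤ) • yN a), Sum.inr (μN a))
            * (perF (towerTorus Lc (fine Lc M) (n + 1)) A (wrapPt (towerTorus Lc (fine Lc M) (n + 1)) (((Lc ^ (n + 1 + 1) : ℕ) : ℤ) • (w : Site (3 + 1))), Sum.inr ρ) (wrapPt (towerTorus Lc (fine Lc M) (n + 1)) (((Lc ^ (n + 1 + 1) : ℕ) : ℤ) • yN a'), Sum.inr (μN a'))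
                * perF (towerTorus Lc (fine Lc M) (n + 1)) (dper (towerTorus Lc (fine Lc M) (n + 1)) (fun X Z i₁ i₂ => ∑' m : Site (3 + 1),
            ((1 / 2 : ℝ) • (M2Of 3 (Lc ^ (n + 1 + 1)) (tabsCompG (n + 1 + 1) (one_le_of_neZero Lc) (Roots.ctr Lc).hr (Pn.cM (n + 1 + 1))).mixFF 0 κ (u : Site (3 + 1)) ρ (translate M (w : Site (3 + 1)) m) + sgnK (trK (M2Of 3 (Lc ^ (n + 1 + 1)) (tabsCompG (n + 1 + 1) (one_le_of_neZero Lc) (Roots.ctr Lc).hr (Pn.cM (n + 1 + 1))).mixFF 0 κ (u : Site (3 + 1)) ρ (translate M (w : Site (3 + 1)) m))))) X Z i₁ i₂)) (p, Sum.inl α) (q, Sum.inl β)))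
          + (∑ u : ↥(pbox (towerTorus Lc (fine Lc M) (n + 1))), ∑ κ : Fin (3 + 1), ∑ w : ↥(pbox M), ∑ ρ : Fin (3 + 1),
          perF (towerTorus Lc (fine Lc M) (n + 1)) A (u, Sum.inl κ) (wrapPt (towerTorus Lc (fine Lc M) (n + 1)) (((Lc ^ (n + 1 + 1) : ℕ) : ℤ) • yN a'), Sum.inr (μN a'))
            * (perF (towerTorus Lc (fine Lc M) (n + 1)) A (wrapPt (towerTorus Lc (fine Lc M) (n + 1)) (((Lc ^ (n + 1 + 1) : ℕ) : ℤ) • (w : Site (3 + 1))), Sum.inr ρ) (wrapPt (towerTorus Lc (fine Lc M) (n + 1)) (((Lc ^ (n + 1 + 1) : ℕ) : ℤ) • yN a), Sum.inr (μN a))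
                * perF (towerTorus Lc (fine Lc M) (n + 1)) (dper (towerTorus Lc (fine Lc M) (n + 1)) (fun X Z i₁ i₂ => ∑' m : Site (3 + 1),
            ((1 / 2 : ℝ) • (M2Of 3 (Lc ^ (n + 1 + 1)) (tabsCompG (n + 1 + 1) (one_le_of_neZero Lc) (Roots.ctr Lc).hr (Pn.cM (n + 1 + 1))).mixFF 0 κ (u : Site (3 + 1)) ρ (translate M (w : Site (3 + 1)) m) + sgnK (trK (M2Of 3 (Lc ^ (n + 1 + 1)) (tabsCompG (n + 1 + 1) (one_le_of_neZero Lc) (Roots.ctr Lc).hr (Pn.cM (n + 1 + 1))).mixFF 0 κ (u : Site (3 + 1)) ρ (translate M (w : Site (3 + 1)) m))))) X Z i₁ i₂)) (p, Sum.inl α) (q, Sum.inl β)))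
        + (-(cM₂ * r) • D) (p, α) (q, β) := by
  -- (J-W″) solved for the nested direction, and the multiplier columns along `r•e_a`
  have hva : ∀ a₀ : κ, hv (r • (Pi.single a₀ (1 : ℝ) : κ → ℝ)) = (r • fun b : ↥(pbox (towerTorus Lc (fine Lc M) (n + 1))) × Fin (3 + 1) =>
        perF (towerTorus Lc (fine Lc M) (n + 1)) A (b.1, Sum.inl b.2)
          (wrapPt (towerTorus Lc (fine Lc M) (n + 1)) (((Lc ^ (n + 1 + 1) : ℕ) : ℤ) • yN a₀), Sum.inr (μN a₀)))
      - (fun b : ↥(pbox (towerTorus Lc (fine Lc M) (n + 1))) × Fin (3 + 1) =>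
            ∑ s : ↥(pbox (towerTorus Lc (fine Lc M) (n + 1))), tgrad (towerTorus Lc (fine Lc M) (n + 1)) (b.1, Sum.inl b.2) s * lv (r • (Pi.single a₀ (1 : ℝ) : κ → ℝ)) s) := fun a₀ =>
    eq_sub_of_add_eq (direction_add_exact_eq_smul_colA M n A yN μN hv hhvl lv hlv hJW r a₀)
  have hma : ∀ (a₀ : κ) (β₀ : ↥(pbox M) × Fin (3 + 1)), hm (r • (Pi.single a₀ (1 : ℝ) : κ → ℝ)) β₀
      = r * perF (towerTorus Lc (fine Lc M) (n + 1)) A (wrapPt (towerTorus Lc (fine Lc M) (n + 1)) (((Lc ^ (n + 1 + 1) : ℕ) : ℤ) • (β₀.1 : Site (3 + 1))), Sum.inr β₀.2)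
              (wrapPt (towerTorus Lc (fine Lc M) (n + 1)) (((Lc ^ (n + 1 + 1) : ℕ) : ℤ) • yN a₀), Sum.inr (μN a₀)) := fun a₀ β₀ => by
    rw [map_smul_of_linear hm hml, Pi.smul_apply, smul_eq_mul, hJM]
  -- the entry, combined by the lock into the `colN̂–Ŝ` words over the road's table letter
  have key : (Λ₂ (r • (Pi.single a (1 : ℝ) : κ → ℝ)) (r • (Pi.single a' (1 : ℝ) : κ → ℝ))
            + c • (Matrix.diagonal (fun b : ↥(pbox (towerTorus Lc (fine Lc M) (n + 1))) × Fin (3 + 1) => lv (r • (Pi.single a (1 : ℝ) : κ → ℝ)) b.1) * Λ₁ (r • (Pi.single a' (1 : ℝ) : κ → ℝ))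
              - Λ₁ (r • (Pi.single a' (1 : ℝ) : κ → ℝ)) * Matrix.diagonal (fun b : ↥(pbox (towerTorus Lc (fine Lc M) (n + 1))) × Fin (3 + 1) => lv (r • (Pi.single a (1 : ℝ) : κ → ℝ)) b.1)
              + (Matrix.diagonal (fun b : ↥(pbox (towerTorus Lc (fine Lc M) (n + 1))) × Fin (3 + 1) => lv (r • (Pi.single a' (1 : ℝ) : κ → ℝ)) b.1) * Λ₁ (r • (Pi.single a (1 : ℝ) : κ → ℝ))
                - Λ₁ (r • (Pi.single a (1 : ℝ) : κ → ℝ)) * Matrix.diagonal (fun b : ↥(pbox (towerTorus Lc (fine Lc M) (n + 1))) × Fin (3 + 1) => lv (r • (Pi.single a' (1 : ℝ) : κ → ℝ)) b.1)))) (p, α) (q, β)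
      = ∑ b : ↥(pbox (towerTorus Lc (fine Lc M) (n + 1))) × Fin (3 + 1), ∑ β₀ : ↥(pbox M) × Fin (3 + 1),
          (perF (towerTorus Lc (fine Lc M) (n + 1)) A (b.1, Sum.inl b.2)
              (wrapPt (towerTorus Lc (fine Lc M) (n + 1)) (((Lc ^ (n + 1 + 1) : ℕ) : ℤ) • yN a), Sum.inr (μN a))
              * perF (towerTorus Lc (fine Lc M) (n + 1)) A (wrapPt (towerTorus Lc (fine Lc M) (n + 1)) (((Lc ^ (n + 1 + 1) : ℕ) : ℤ) • (β₀.1 : Site (3 + 1))), Sum.inr β₀.2)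
              (wrapPt (towerTorus Lc (fine Lc M) (n + 1)) (((Lc ^ (n + 1 + 1) : ℕ) : ℤ) • yN a'), Sum.inr (μN a'))
            + perF (towerTorus Lc (fine Lc M) (n + 1)) A (b.1, Sum.inl b.2)
              (wrapPt (towerTorus Lc (fine Lc M) (n + 1)) (((Lc ^ (n + 1 + 1) : ℕ) : ℤ) • yN a'), Sum.inr (μN a'))
              * perF (towerTorus Lc (fine Lc M) (n + 1)) A (wrapPt (towerTorus Lc (fine Lc M) (n + 1)) (((Lc ^ (n + 1 + 1) : ℕ) : ℤ) • (β₀.1 : Site (3 + 1))), Sum.inr β₀.2)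
              (wrapPt (towerTorus Lc (fine Lc M) (n + 1)) (((Lc ^ (n + 1 + 1) : ℕ) : ℤ) • yN a), Sum.inr (μN a))) * M₂ b β₀ (p, α) (q, β) - (cM₂ * r) * D (p, α) (q, β) := by
    rw [Matrix.add_apply, hJΛ₂', hΛ₂, hva a, hva a']
    simp only [hma, Pi.sub_apply, Pi.smul_apply, smul_eq_mul, Matrix.smul_apply, Matrix.sum_apply, Matrix.sub_apply]
    rw [← add_sub_assoc, sub_left_inj]
    exact mixed_lock_combine cM₂ r hcM₂ _ _ _ _ _ _ _
  rw [key, Matrix.smul_apply, smul_eq_mul, neg_mul, ← sub_eq_add_neg, sub_left_inj]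
  simp only [add_mul, Finset.sum_add_distrib, hM₂, Matrix.submatrix_apply, Fintype.sum_prod_type, mul_assoc]

end MixedMD

end Summit.QuantumFields.BalabanUV.Beta.FP.TowerHN2ReadersChartGenericG.MixedDoor

end
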